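import Summits.ResolutionOfSingularities.ResolutionOfSingularities.Theorems.FrobeniusLadderFInjectiveMacaulayficationProp44SliceCurveUnconditional
import Summits.ResolutionOfSingularities.ResolutionOfSingularities.Theorems.FrobeniusLadderFInjectiveMacaulayficationProp44SliceTauOnePointOfT1
import Summits.ResolutionOfSingularities.ResolutionOfSingularities.Theorems.FrobeniusLadderFInjectiveMacaulayficationProp44PointStepCurves
import Summits.ResolutionOfSingularities.ResolutionOfSingularities.Theorems.FrobeniusLadderFInjectiveMacaulayficationProp44T1OfN2fullPrime
import Summits.ResolutionOfSingularities.ResolutionOfSingularities.Theorems.FrobeniusLadderFInjectiveMacaulayficationProp44ReachTidy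
import Summits.ResolutionOfSingularities.ResolutionOfSingularities.Theorems.FrobeniusLadderFInjectiveMacaulayficationProp44TidyPieces
import Literature.AlgebraicGeometry.Resolution.CurveCentreNearPointGammaPrimeRegular
import Summits.ResolutionOfSingularities.ResolutionOfSingularities.Theorems.FrobeniusLadderFInjectiveMacaulayficationProp44InvariantsDim
import Summits.ResolutionOfSingularities.ResolutionOfSingularities.Theorems.FrobeniusLadderFInjectiveMacaulayficationProp44SliceDimTwoComap
import Summits.ResolutionOfSingularities.ResolutionOfSingularities.Theorems.MarkedTransferCampaignW46ThreefoldsTauTwoLocusSlice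
import Literature.AlgebraicGeometry.Resolution.CompletedChainDescent
import HarnessLib

/-!
# Cossart–Piltant 2008, Prop. 4.4 (`CossartPiltant2008_prop44`, F-71) — THE ASSEMBLY (sorry-free)

OURS (res-inputs-p-8b g2, from assembly skeleton v5.5 b0452fb04f8a7f45; D-0154 (2) RES inputs cell, L1 W4.5a crux `FInjectiveMacaulayfication`
stmt-ResolutionOfSingularities-15315). **PROVED here: `cossartPiltant2008_prop44_holds : CossartPiltant2008_prop44`** — [CoP1] Prop. 4.4 in the
tree's W4.6 currency («an order-`μ` marked ideal on an excellent regular threefold with `dim V(J) ≤ 1` becomes order-reducible after a permissible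
blow-up sequence»), by PATCHING SLICES:
* the DICTIONARY `cossartPiltant2008_prop44_of_orderReducible` (p611578) and `OrderReducible.of_isPermissibleBlowupSeq` (W4.6);
* the INVARIANTS `prop44Invariants_stage` (p615828) and PATCHING `OrderReducible.of_opens_finite` (p508549) over the pieces of a TIDY bad locus;
* the slices: `τ ≥ 2` threefold point (`orderReducible_comap_of_isolated_two_le_tau`), coheight-2 point (`orderReducible_comap_of_isolated_coheight_two`),
  regular curve (`stub_curve`, derived from the tree), the `τ = 1` isolated point (`stub_tauOne_point`, derived by name from p624200 over
  `stub_rho1'` := `pointStep_curves'` p624630 and `stub_T1`), REACH-TIDY (`reach_tidy`, res-inputs-p-5a);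
* **`stub_T1` (no infinite chain of `τ = 1` near points, SIGNATURES v4 l.340) := `T1_of_N2full' stub_N2full' …`** (res-inputs-p-8b,
  `…Prop44T1OfN2fullPrime.lean` p637158: the scheme side — T1-α p623079, σ/σ′ p626364 (res-inputs-p-6), κ p624926, κ″ p626243, line centre p627545,
  T1Glue p628866, F1–F6) over **`stub_N2full'` := `Literature.AlgebraicGeometry.Resolution.false_of_fullChain_tau_one'`** (CONTRACT v3′
  4da8544dee9e0b4d; res-inputs-p-7b g3 `CompletedChainDescent.lean` p639933 — the β-descent down the completed chain with totally prepared labels,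
  CJS 2020 Thm. 13.7 — over res-inputs-p-7b g2's CONTRACT v2 `false_of_unitChain_tau_one_rational` p634171 and res-inputs-p-8a's completed steps /
  polygon laws / swap packet / chart exclusion, res-inputs-p-8b's A-i/A-ii and `AdaptedCentrePresentation`).
The inner names `stub_*` are historical (they were the sorried slots of skeletons v1–v5.5); every one of them is a theorem here.

HONEST STATUS: AI-written; AI kernel work and AI review are weaker than expert review. This file proves the tree's Lean statement
`Literature.AlgebraicGeometry.Resolution.CossartPiltant2008_prop44` (universe-polymorphic, as audited by the operator) and nothing else: resolution of
singularities in dimension `≥ 4` or in positive characteristic is NOT proved here; no statement of a manuscript under adjudication is proved here.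
[cite: CossartPiltant2008, Prop. 4.4, Lemma 4.5] [cite: CossartJannsenSaito2020, Thm. 13.7, Cor. 8.24]
-/

-- `Summit.<Summit>.<Sub>.Theorems` with `Sub = Summit` (single-conjunct summit, D-0017)
set_option linter.dupNamespace false

noncomputable section

open CategoryTheory AlgebraicGeometry TopologicalSpace IsLocalRing MvPolynomial
open Literature.AlgebraicGeometry.Resolution Scheme.IdealSheafData

namespace Summit.ResolutionOfSingularities.ResolutionOfSingularities.Theorems

namespace CP2008Prop44

universe u

/-! ## The piece kinds of a tidy stage (no definitions: spelled out as propositions) -/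

/-! ### The ONE remaining slot of the T1 line: the ring CONTRACT v3′ (OPTION R, critic R106/R112; tree `T1_of_N2full'`, p-8b) -/

/-- **`stub_T1` (SIGNATURES v4 l.340 VERBATIM) := `T1_of_N2full' false_of_fullChain_tau_one' …`** — the tree theorem `T1_of_N2full'`
(res-inputs-p-8b, `…Prop44T1OfN2fullPrime.lean`) over the ring theorem `false_of_fullChain_tau_one'` (res-inputs-p-7b g3, CONTRACT v3′): **no infinite chain of
`τ = 1` near points under permissible blow-ups in the regime (*)**. [cite: CossartPiltant2008, Prop. 4.4 (proof, p. 11)] -/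
theorem stub_T1 (Xs : ℕ → Scheme.{u})
    (hN : ∀ n, IsLocallyNoetherian (Xs n)) (hXreg : ∀ n, Scheme.IsRegular (Xs n))
    (π : ∀ n, Xs (n + 1) ⟶ Xs n) (Y : ∀ n, Closeds (Xs n)) (y : ∀ n, Xs (n + 1))
    (J : ∀ n, (Xs n).IdealSheafData) {μ : ℕ} (hμ : 1 ≤ μ)
    (hy : ∀ n, π (n + 1) (y (n + 1)) = y n)
    (hmem : ∀ n, π n (y n) ∈ (Y n : Set (Xs n)))
    (hcl : ∀ n, IsClosed ({π n (y n)} : Set (Xs n)))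
    (hYirr : ∀ n, IsIrreducible ((Y n : Closeds (Xs n)) : Set (Xs n)))
    (hYreg : ∀ n, Scheme.IsRegular (vanishingIdeal (Y n)).subscheme)
    (hYord : ∀ n, ∀ z ∈ (Y n : Set (Xs n)), idealOrder (J n) z = μ)
    (hπ : ∀ n, IsBlowup (π n) (vanishingIdeal (Y n)))
    (hJ : ∀ n, J (n + 1) = controlledTransform (π n) (vanishingIdeal (Y n)) (J n) μ)
    (hbd : ∀ n (z : Xs n), idealOrder (J n) z ≤ μ)
    (hcodim : ∀ n, ∀ z ∈ (J n).support, 1 < Order.coheight z)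
    (hd : ∀ n, (maximalIdeal ((Xs n).presheaf.stalk (π n (y n)))).spanFinrank = 3)
    (hnear : ∀ n, IsNear (π n) (vanishingIdeal (Y n)) (J n) μ (y n))
    (hτ : ∀ n, @stalkTau (Xs n) (J n) (π n (y n)) (hXreg n (π n (y n))) μ = 1)
    (hG : ∀ n, IsGRing ((Xs n).presheaf.stalk (π n (y n))))
    (hcoinc : ∀ n (z : Xs n), z ⤳ π n (y n) → idealOrder (J n) z = μ → z ∈ (Y n : Set (Xs n))) :
    False :=
  T1_of_N2full' false_of_fullChain_tau_one' Xs hN hXreg π Y y J hμ hy hmem hcl hYirr hYreg hYord hπ hJ hbd hcodim hd hnear hτ hG hcoinc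

/-- FORMER ORACLE ρ1′, NOW THE TREE THEOREM `CP2008Prop44.pointStep_curves'` (res-inputs-p-5a, p624630): the point-step curve bookkeeping in the
«equal or disjoint» form = the `hρ1` section variable of `orderReducible_comap_of_isolated_tau_one_of_T1` (tree StepP :141–155), binders verbatim.
[cite: CossartPiltant2008, Lemma 4.3 (5), Prop. 4.4 (proof, p. 11)] -/
theorem stub_rho1' ⦃X X' : Scheme.{u}⦄ [IsLocallyNoetherian X] [IsLocallyNoetherian X'] (hX : Scheme.IsRegular X)
    (hX3 : topologicalKrullDim X ≤ 3) (J : X.IdealSheafData) ⦃μ : ℕ⦄ (hμ : 1 ≤ μ) (hle : ∀ z, idealOrder J z ≤ μ)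
    (hcodim : ∀ z ∈ J.support, 1 < Order.coheight z) ⦃x : X⦄ (hx : IsClosed ({x} : Set X)) (hord : idealOrder J x = μ)
    (hdim : (maximalIdeal (X.presheaf.stalk x)).spanFinrank = 3) ⦃π : X' ⟶ X⦄
    (hπ : IsBlowup π (vanishingIdeal ⟨{x}, hx⟩)) ⦃η' : X'⦄
    (hη' : η' ∈ maxPoints {z : X' | (μ : ℕ∞) ≤ idealOrder (controlledTransform π (vanishingIdeal ⟨{x}, hx⟩) J μ) z})
    (hη'cl : ¬ IsClosed ({η'} : Set X')) :
    (π η' ≠ x ∧ π η' ∈ maxPoints {z : X | (μ : ℕ∞) ≤ idealOrder J z} ∧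
        closure ({η'} : Set X') = closure (π ⁻¹' (closure {π η'} \ {x}))) ∨
      (π η' = x ∧ Scheme.IsRegular (vanishingIdeal (⟨closure {η'}, isClosed_closure⟩ : Closeds X')).subscheme ∧
        (∀ y ∈ closure ({η'} : Set X'), ∀ hr : IsRegularLocalRing (X'.presheaf.stalk y),
          ∃ c : Fin 2 → X'.presheaf.stalk y, @IsRsopPart _ _ _ 2 c ∧
            Ideal.span (Set.range c) = stalkIdeal (vanishingIdeal (⟨closure {η'}, isClosed_closure⟩ : Closeds X')) y) ∧
        ∀ η'' ∈ maxPoints {z : X' | (μ : ℕ∞) ≤ idealOrder (controlledTransform π (vanishingIdeal ⟨{x}, hx⟩) J μ) z},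
          ¬ IsClosed ({η''} : Set X') → π η'' = x → η'' = η' ∨ Disjoint (closure ({η'} : Set X')) (closure {η''})) :=
  pointStep_curves' hX hX3 J hμ hle hcodim hx hord hdim hπ hη' hη'cl

/-- FORMER STUB `stub_tauOne_point` (RICH form, v5.2 binders VERBATIM), NOW DERIVED from the tree theorem
`orderReducible_comap_of_isolated_tau_one_of_T1` (res-inputs-p-8a, p624200: the S3 descent) over `stub_rho1'` (tree) and the sorried `stub_T1`:
the `τ = 1` ISOLATED-POINT slice relative to an open. `X` integral Noetherian regular quasi-excellent of dimension `≤ 3`, `J`, `m ≥ 1`, `ord ≤ m`,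
`V(J)` of codimension `≥ 2`, `V ⊆ X` open, `x ∈ V` closed, every point of order `≥ m` equal to `x` or outside `V`, `ord_x J = m`, embedding dimension `3`,
`τ_x(J, m) = 1`, `𝒪_{X,x}` a G-ring ⊢ `(V, J|_V, m)` order-reducible. [cite: CossartPiltant2008, Lemma 4.5, Prop. 4.4 (proof, p. 11)] -/
theorem stub_tauOne_point {X : Scheme.{u}} [IsIntegral X] [IsNoetherian X] (hX : Scheme.IsRegular X) (hqe : Scheme.IsQuasiExcellent X)
    (hX3 : topologicalKrullDim X ≤ 3) (J : X.IdealSheafData) {m : ℕ} (hm : 1 ≤ m) (hle : ∀ z, idealOrder J z ≤ m)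
    (hcodim : ∀ z ∈ J.support, 1 < Order.coheight z) (V : X.Opens) (x : X) (hxV : x ∈ V)
    (hcl : IsClosed ({x} : Set X)) (hbad : ∀ z : X, (m : ℕ∞) ≤ idealOrder J z → z = x ∨ z ∉ (V : Set X))
    (hord : idealOrder J x = m) (hdim : (maximalIdeal (X.presheaf.stalk x)).spanFinrank = 3)
    (hτ : haveI := hX x; stalkTau J x m = 1) (hG : IsGRing (X.presheaf.stalk x)) :
    CampaignW46.OrderReducible (J.comap V.ι) m :=
  orderReducible_comap_of_isolated_tau_one_of_T1 hm stub_rho1' stub_T1 hX hqe hX3 J hle hcodim V x hxV hcl hbad hord hdim hτ hG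

/-- FORMER STUB T2b′, NOW THE TREE THEOREM `IsBlowup.isRegular_gammaPrime_of_isNear_curve` (res-inputs-p-6, p622153) — [CoP1] Lemma 4.3 (4), the curve
`Γ′`; binders of `stub_T2b'_isRegular_gammaPrime` (SIGNATURES v3 l.212 / v4 l.214) VERBATIM. [cite: CossartPiltant2008, Lemma 4.3 (4)] -/
theorem stub_T2b' ⦃X' X : Scheme.{u}⦄ [IsLocallyNoetherian X] [IsLocallyNoetherian X'] (hX : Scheme.IsRegular X) ⦃π : X' ⟶ X⦄
    ⦃Y : Closeds X⦄ (hYirr : IsIrreducible ((Y : Closeds X) : Set X))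
    (hreg : Scheme.IsRegular (vanishingIdeal Y).subscheme) (hπ : IsBlowup π (vanishingIdeal Y))
    ⦃J : X.IdealSheafData⦄ ⦃μ : ℕ⦄ (hμ : 1 ≤ μ) (hY : ∀ y ∈ (Y : Set X), idealOrder J y = μ)
    (hJ : ∀ x, idealOrder J x ≤ μ) ⦃η' : X'⦄ (hη' : closure {π η'} = (Y : Set X))
    (hcodim : Order.coheight (π η') = 2) (hnear : IsNear π (vanishingIdeal Y) J μ η') :
    Scheme.IsRegular (vanishingIdeal (⟨closure {η'}, isClosed_closure⟩ : Closeds X')).subscheme ∧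
      (∀ z ∈ closure ({η'} : Set X'), IsNear π (vanishingIdeal Y) J μ z) ∧
      π '' closure ({η'} : Set X') = (Y : Set X) :=
  hπ.isRegular_gammaPrime_of_isNear_curve hX hYirr hreg hμ hY hJ hη' hcodim hnear

/-- FORMER STUB, NOW DERIVED (tree `stub_curve_of_pointSliceRich`, p622862): the regular-curve slice from `stub_tauOne_point` (RICH form) alone.
[cite: CossartPiltant2008, Lemma 4.3 (2) (4), Lemma 4.5 (1), Prop. 4.4] -/
theorem stub_curve {X : Scheme.{u}} [IsIntegral X] [IsNoetherian X] (hX : Scheme.IsRegular X)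
    (hqe : Scheme.IsQuasiExcellent X) (hX3 : topologicalKrullDim X ≤ 3) (J : X.IdealSheafData) {m : ℕ} (hm : 1 ≤ m)
    (hle : ∀ z, idealOrder J z ≤ m)
    (hcodim : ∀ z ∈ J.support, 1 < Order.coheight z) (V : X.Opens) (Y : Closeds X)
    (hreg : Scheme.IsRegular (vanishingIdeal Y).subscheme) (hirr : IsIrreducible (Y : Set X)) (hYV : (Y : Set X) ⊆ (V : Set X))
    (hJY : ∀ z : X, (m : ℕ∞) ≤ idealOrder J z → z ∈ (Y : Set X) ∨ z ∉ (V : Set X))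
    (hord : ∀ y ∈ (Y : Set X), idealOrder J y = m)
    (hcurve : ∀ y ∈ (Y : Set X), haveI := hX y; ∃ c : Fin 2 → X.presheaf.stalk y, IsRsopPart c ∧
      Ideal.span (Set.range c) = stalkIdeal (vanishingIdeal Y) y)
    (hτ1 : ¬ ∀ y ∈ (Y : Set X), haveI := hX y; 2 ≤ stalkTau J y m) :
    CampaignW46.OrderReducible (J.comap V.ι) m :=
  stub_curve_of_pointSliceRich hX hqe hX3 J hm hle hcodim V Y hreg hirr hYV hJY hord hcurve hτ1
    fun _ _ _ hX hqe hX3 J _ hm hle hcodim V x hxV hcl hbad hord hdim hτ hG =>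
      stub_tauOne_point hX hqe hX3 J hm hle hcodim V x hxV hcl hbad hord hdim hτ hG

/-- FORMER STUB, NOW DERIVED (tree p620749 `stub_reach_of_reachTidy`): the tidy-stage pieces from res-inputs-p-5a's `reach_tidy` (`…Prop44ReachTidy.lean`).
[cite: CossartPiltant2008, Prop. 4.4 (proof, pp. 9–10, steps 1–3, (*))] -/
theorem stub_reach {X : Scheme.{u}} [IsIntegral X] [IsNoetherian X] (hX : Scheme.IsRegular X) (hqe : Scheme.IsQuasiExcellent X)
    (hX3 : topologicalKrullDim X ≤ 3) (J : X.IdealSheafData) {μ : ℕ} (hμ : 1 ≤ μ) (hle : ∀ z, idealOrder J z ≤ μ)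
    (hcodim : ∀ z ∈ J.support, 1 < Order.coheight z) :
    ∃ (X₁ : Scheme.{u}) (Φ : X₁ ⟶ X) (J₁ : X₁.IdealSheafData) (_ : CampaignW46.IsPermissibleBlowupSeq J μ Φ J₁)
      (n : ℕ) (Z : Fin n → Set X₁),
      (∀ i, IsClosed (Z i)) ∧ (∀ i j, i ≠ j → Disjoint (Z i) (Z j)) ∧
      (∀ z : X₁, (μ : ℕ∞) ≤ idealOrder J₁ z → ∃ i, z ∈ Z i) ∧
      ∀ i, (∃ x : X₁, Z i = {x} ∧ idealOrder J₁ x = μ ∧ (maximalIdeal (X₁.presheaf.stalk x)).spanFinrank = 3 ∧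
              ∀ hr : IsRegularLocalRing (X₁.presheaf.stalk x), 2 ≤ @stalkTau X₁ J₁ x hr μ) ∨
           (∃ x : X₁, Z i = {x} ∧ idealOrder J₁ x = μ ∧ (maximalIdeal (X₁.presheaf.stalk x)).spanFinrank = 3 ∧
              ∀ hr : IsRegularLocalRing (X₁.presheaf.stalk x), @stalkTau X₁ J₁ x hr μ = 1) ∨
           (∃ x : X₁, Z i = {x} ∧ idealOrder J₁ x = μ ∧ Order.coheight x = 2) ∨
           (∃ Y : Closeds X₁, Z i = (Y : Set X₁) ∧ Scheme.IsRegular (vanishingIdeal Y).subscheme ∧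
              IsIrreducible (Y : Set X₁) ∧ (∀ y ∈ (Y : Set X₁), idealOrder J₁ y = μ) ∧
              ∀ y ∈ (Y : Set X₁), ∀ hr : IsRegularLocalRing (X₁.presheaf.stalk y),
                ∃ c : Fin 2 → X₁.presheaf.stalk y, @IsRsopPart _ _ _ 2 c ∧
                  Ideal.span (Set.range c) = stalkIdeal (vanishingIdeal Y) y) :=
  stub_reach_of_reachTidy hX hqe hX3 J hμ hle hcodim (reach_tidy hX hqe hX3 J hμ hle hcodim)

/-! ## The composition (PROVED) -/

/-- **Patching over a tidy stage (PROVED): if the order-`≥ m` locus is covered by finitely many pairwise disjoint closed pieces and each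
piece is order-reducible relative to the complement of the others, the input is order-reducible.** (W4.6 `OrderReducible.of_opens_finite` with
`V i = X ∖ ⋃_{j ≠ i} Z j`.) [cite: Piltant2013, Prop. 5.1 (proof, Step 2)] -/
theorem orderReducible_of_pieces {X : Scheme.{u}} [IsLocallyNoetherian X] (hX : Scheme.IsRegular X) (J : X.IdealSheafData)
    (m : ℕ) {n : ℕ} (Z : Fin n → Set X) (hZc : ∀ i, IsClosed (Z i)) (hdisj : ∀ i j, i ≠ j → Disjoint (Z i) (Z j))
    (hcov : ∀ z : X, (m : ℕ∞) ≤ idealOrder J z → ∃ i, z ∈ Z i)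
    (hpiece : ∀ i (V : X.Opens), (V : Set X) = (⋃ j ∈ {j : Fin n | j ≠ i}, Z j)ᶜ →
      CampaignW46.OrderReducible (J.comap V.ι) m) :
    CampaignW46.OrderReducible J m := by
  classical
  have hcl : ∀ i : Fin n, IsClosed (⋃ j ∈ {j : Fin n | j ≠ i}, Z j) := fun i =>
    (Set.toFinite _).isClosed_biUnion fun j _ => hZc j
  let V : Fin n → X.Opens := fun i => ⟨(⋃ j ∈ {j : Fin n | j ≠ i}, Z j)ᶜ, (hcl i).isOpen_compl⟩
  have hV : ∀ i, ((V i : X.Opens) : Set X) = (⋃ j ∈ {j : Fin n | j ≠ i}, Z j)ᶜ := fun i => rfl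
  refine CampaignW46.OrderReducible.of_opens_finite n hX J m V Z hZc (fun i => ?_) (fun i j hij => ?_) hcov
    (fun i => hpiece i (V i) (hV i))
  · intro z hz
    rw [hV, Set.mem_compl_iff, Set.mem_iUnion₂]
    rintro ⟨j, hj, hzj⟩
    exact Set.disjoint_left.mp (hdisj i j (Ne.symm hj)) hz hzj
  · rw [hV]
    exact Set.disjoint_left.mpr fun z hz hzV => hzV (Set.mem_iUnion₂.mpr ⟨i, hij, hz⟩)

/-- In the situation of `orderReducible_of_pieces`: a point of order `≥ m` lies in `Z i` or outside `V i`. [folklore] -/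
private theorem mem_or_not_mem_of_cover {X : Scheme.{u}} {J : X.IdealSheafData} {m : ℕ} {n : ℕ} {Z : Fin n → Set X}
    (hcov : ∀ z : X, (m : ℕ∞) ≤ idealOrder J z → ∃ i, z ∈ Z i) (i : Fin n) (V : X.Opens)
    (hV : (V : Set X) = (⋃ j ∈ {j : Fin n | j ≠ i}, Z j)ᶜ) (z : X) (hz : (m : ℕ∞) ≤ idealOrder J z) :
    z ∈ Z i ∨ z ∉ (V : Set X) := by
  obtain ⟨j, hj⟩ := hcov z hz
  by_cases hji : j = i
  · exact Or.inl (hji ▸ hj)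
  · right
    rw [hV, Set.mem_compl_iff, not_not]
    exact Set.mem_iUnion₂.mpr ⟨j, hji, hj⟩

/-- A piece contained in `V i`. [folklore] -/
private theorem subset_of_cover {X : Scheme.{u}} {n : ℕ} {Z : Fin n → Set X} (hdisj : ∀ i j, i ≠ j → Disjoint (Z i) (Z j))
    (i : Fin n) (V : X.Opens) (hV : (V : Set X) = (⋃ j ∈ {j : Fin n | j ≠ i}, Z j)ᶜ) : Z i ⊆ (V : Set X) := by
  intro z hz
  rw [hV, Set.mem_compl_iff, Set.mem_iUnion₂]
  rintro ⟨j, hj, hzj⟩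
  exact Set.disjoint_left.mp (hdisj i j (Ne.symm hj)) hz hzj

set_option maxHeartbeats 800000 in
/-- **[CoP1] Prop. 4.4 — `CossartPiltant2008_prop44` HOLDS (OURS; sorry-free assembly).** For every admissible input: reach a tidy stage (`stub_reach`),
carry the invariants there (`prop44Invariants_stage`), settle each piece relative to the complement of the others — τ ≥ 2 threefold point by
W4.6's `orderReducible_comap_of_isolated_two_le_tau` (G-ring from quasi-excellence), τ = 1 threefold point by `stub_tauOne_point`, coheight-2
point by `orderReducible_comap_of_isolated_coheight_two` (PROVED), regular curve by `stub_curve` — patch (`orderReducible_of_pieces`), compose with the reach sequence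
(`OrderReducible.of_isPermissibleBlowupSeq`), and translate by the dictionary (`cossartPiltant2008_prop44_of_orderReducible`).
[cite: CossartPiltant2008, Prop. 4.4] -/
theorem cossartPiltant2008_prop44_holds : CossartPiltant2008_prop44.{u} := by
  refine cossartPiltant2008_prop44_of_orderReducible fun S _ _ hS hexc hdimS I _ X ρ _ _ hρ J μ hμ hcodim hle _ => ?_
  have hX : Scheme.IsRegular X := hρ.isRegular hS
  have hqe : Scheme.IsQuasiExcellent X := hρ.isQuasiExcellent hexc
  -- v3 rider (a): the stage is a threefold (`…Prop44InvariantsDim.lean`)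
  have hX3 : topologicalKrullDim X ≤ 3 := topologicalKrullDim_stage_le hρ inferInstance (n := 3) hdimS.le
  obtain ⟨X₁, Φ, J₁, hseq, n, Z, hZc, hdisj, hcov, hkind⟩ := stub_reach hX hqe hX3 J hμ hle hcodim
  obtain ⟨hint₁, hnoeth₁, hX₁, hqe₁, hle₁, hcodim₁, hG₁⟩ := prop44Invariants_stage S hS hexc I X ρ hρ J μ hμ hcodim hle hseq
  -- v3 rider (b): so is the tidy stage reached by the W4.6 sequence
  have hX3₁ : topologicalKrullDim X₁ ≤ 3 := prop44Invariants_stage_dim hρ (n := 3) hdimS.le hseq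
  haveI := hint₁
  haveI := hnoeth₁
  refine CampaignW46.OrderReducible.of_isPermissibleBlowupSeq hseq
    (orderReducible_of_pieces hX₁ J₁ μ Z hZc hdisj hcov fun i V hV => ?_)
  have hbad := mem_or_not_mem_of_cover hcov i V hV
  have hZV := subset_of_cover hdisj i V hV
  rcases hkind i with ⟨x, hZ, hord, hdim, hτ⟩ | ⟨x, hZ, hord, hdim, hτ⟩ | ⟨x, hZ, hord, hcoh⟩ | ⟨Y, hZ, hreg, hirr, hordY, hcurve⟩
  · -- τ ≥ 2 threefold point: PROVED slice
    have hxV : x ∈ V := hZV (by rw [hZ]; exact Set.mem_singleton x)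
    have hcl : IsClosed ({x} : Set X₁) := hZ ▸ hZc i
    haveI := hX₁ x
    exact CampaignW46.orderReducible_comap_of_isolated_two_le_tau hX₁ J₁ hμ V x hxV hcl
      (fun z hz => (hbad z hz).imp (fun h => by rw [hZ] at h; exact h) id) hord hdim (hτ (hX₁ x)) (hG₁ x)
  · -- τ = 1 threefold point: STUB
    have hxV : x ∈ V := hZV (by rw [hZ]; exact Set.mem_singleton x)
    have hcl : IsClosed ({x} : Set X₁) := hZ ▸ hZc i
    exact stub_tauOne_point hX₁ hqe₁ hX3₁ J₁ hμ hle₁ hcodim₁ V x hxV hcl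
      (fun z hz => (hbad z hz).imp (fun h => by rw [hZ] at h; exact h) id) hord hdim (hτ (hX₁ x)) (hG₁ x)
  · -- coheight-2 point: PROVED slice (`…Prop44SliceDimTwoComap.lean`)
    have hxV : x ∈ V := hZV (by rw [hZ]; exact Set.mem_singleton x)
    have hcl : IsClosed ({x} : Set X₁) := hZ ▸ hZc i
    exact orderReducible_comap_of_isolated_coheight_two hX₁ J₁ hμ hle₁ hcodim₁ V x hxV hcl
      (fun z hz => (hbad z hz).imp (fun h => by rw [hZ] at h; exact h) id) hord hcoh
  · -- regular curve: τ ≥ 2 everywhere ⇒ PROVED W4.6 slice; a τ = 1 point on it ⇒ STUB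
    by_cases hall : ∀ y ∈ (Y : Set X₁), haveI := hX₁ y; 2 ≤ stalkTau J₁ y μ
    · exact CampaignW46.orderReducible_comap_of_curve_two_le_tau hX₁ J₁ hμ V Y hreg
        (fun z hz => (hbad z hz).imp (fun h => by rw [hZ] at h; exact h) id) hordY
        (fun y hy => by
          obtain ⟨c, hcr, hcY⟩ := hcurve y hy (hX₁ y)
          exact ⟨c, hcr, hcY, hall y hy⟩)
    · exact stub_curve hX₁ hqe₁ hX3₁ J₁ hμ hle₁ hcodim₁ V Y hreg hirr (hZ ▸ hZV)
        (fun z hz => (hbad z hz).imp (fun h => by rw [hZ] at h; exact h) id) hordY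
        (fun y hy => hcurve y hy (hX₁ y)) hall

end CP2008Prop44

end Summit.ResolutionOfSingularities.ResolutionOfSingularities.Theorems

end
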